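import Literature.AlgebraicGeometry.ShimuraVarieties.HeckeCorrespondenceAction
import Literature.AlgebraicGeometry.HodgeTheory.KaehlerClassPullback
import Literature.Geometry.Manifold.CoveringSpaceManifold
import Literature.Geometry.Kaehler.KaehlerPullback

/-!
# The level cover of a compact ball quotient is Kähler for the complex structure lifted from a
# Hodge model (crux `EndoscopicMiddleDegree.OrthogonalEnveloped`, stmt-HodgeConjecture-14300;
# `--supports`; line `purity-sorted-hecke-envelope`, stub `stub_levelCoverKaehler`)

For a ball-quotient datum `D`, a Hodge model `A` of `X` (a complex manifold `A.carrier` charted on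
`A.model`, homeomorphic to `X(ℂ)` through `φ := A.isAnalytification.isHomeomorph.homeomorph`) and a
normal subgroup `N ⊴ Γ` such that `pL := φ⁻¹ ∘ (D.levelProj N) : N \ 𝔹 → A.carrier` is a local
homeomorphism, the level cover `L := D.LevelCover N` carries the LIFTED atlas
`Literature.Geometry.Manifold.liftChartedSpace hp` (Lee 2012, Prop. 4.40), for which `pL` reads as
the identity in charts. We prove (REGISTERED stub `stub_levelCoverKaehler` of the lead's skeleton,
signature byte-identical):

* if `A.carrier` is a Kähler manifold then so is `L` (for the lifted complex and real structures,
  taken as hypotheses): pull back a smooth Kähler metric of `A.carrier` along `pL`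
  (`Literature.Geometry.Kaehler.exists_isKaehler_inner_eq_pullback`: the pull-back of a Kähler metric
  along a holomorphic immersion is Kähler, Voisin I §3.1.3 p. 70). The three hypotheses of that
  theorem: `pL` is `C^∞` and holomorphic (`contMDiff_proj_of_chartAt_eq`, identity in the lifted
  charts), so its real differential is `ℂ`-linear (`mfderiv_tangentJ`), and it is injective
  (`bijective_mfderiv_proj_of_chartAt_eq`, Lee Prop. 4.33 (a)).

References: C. Voisin, *Hodge Theory and Complex Algebraic Geometry I* (2002), §3.1.3;
J. M. Lee, *Introduction to Smooth Manifolds*, 2nd ed. (2012), Prop. 4.33 (a), Prop. 4.40.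
-/

noncomputable section

-- The crux-workfile namespace `Summit.<P>.<Sub>.Cruxes.…` repeats `HodgeConjecture` (single-conjunct summit).
set_option linter.dupNamespace false

namespace Summit.HodgeConjecture.HodgeConjecture.Cruxes.OrthogonalEnveloped.PuritySortedHeckeEnvelope

open scoped Manifold ContDiff
open Literature.AlgebraicGeometry.Motives (SchemeOver ComplexPoints IsSmoothProjective)
open Literature.AlgebraicGeometry.HodgeTheory
open Literature.AlgebraicGeometry.ShimuraVarieties
open Literature.Geometry.Manifold (liftChartedSpace coveringPiece isManifold_of_atlas_eq_lift
  contMDiff_proj_of_chartAt_eq bijective_mfderiv_proj_of_chartAt_eq)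
open Literature.Geometry.Kaehler (IsKaehlerManifold tangentJ exists_isKaehler_inner_eq_pullback)

/-- **Stub L3 — the level cover is Kähler.** With the lifted complex structure, `N \ 𝔹` is a Kähler
manifold as soon as `A.carrier` is: pull back a smooth Kähler metric of `A.carrier` along the local
biholomorphism `pL` (`Literature.Geometry.Kaehler.exists_isKaehler_inner_eq_pullback`: the pull-back of a Kähler
metric along a holomorphic immersion is Kähler; `pL` is `C^∞` with bijective `ℂ`-linear differentials,
`contMDiff_proj_of_chartAt_eq`, `bijective_mfderiv_proj_of_chartAt_eq`, `mfderiv_tangentJ`).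
[cite: VoisinHodgeI2002, §3.1.3 p. 70] [cite: LeeSmoothManifolds2013, Prop. 4.40] -/
theorem stub_levelCoverKaehler :
    ∀ {p : ℕ} {X : SchemeOver ℂ} (D : UnitaryBallQuotientDatum p X) (A : HodgeModel p X)
      (N : Subgroup ↥D.Γ) [N.Normal]
      (hp : IsLocalHomeomorph (A.isAnalytification.isHomeomorph.homeomorph.symm ∘ D.levelProj N)),
      IsKaehlerManifold A.model A.carrier →
      letI : ChartedSpace A.model (D.LevelCover N) := liftChartedSpace hp
      ∀ [IsManifold 𝓘(ℂ, A.model) ω (D.LevelCover N)] [IsManifold 𝓘(ℝ, A.model) ∞ (D.LevelCover N)],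
        IsKaehlerManifold A.model (D.LevelCover N) := by
  intro p X D A N _ hp hK
  letI : ChartedSpace A.model (D.LevelCover N) := liftChartedSpace hp
  intro _ _
  -- a smooth Kähler metric on the Hodge model
  obtain ⟨G, hG⟩ := hK.exists_isKaehler
  -- the projection `pL = φ⁻¹ ∘ π : N \ 𝔹 → A.carrier`, the identity in the lifted charts
  have hchart : ∀ e : D.LevelCover N, chartAt A.model e =
      (coveringPiece hp e).trans (chartAt A.model
        ((A.isAnalytification.isHomeomorph.homeomorph.symm ∘ D.levelProj N) e)) := fun _ ↦ rfl
  -- `pL` is `C^∞` …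
  have hψ : ContMDiff 𝓘(ℝ, A.model) 𝓘(ℝ, A.model) ∞
      (A.isAnalytification.isHomeomorph.homeomorph.symm ∘ D.levelProj N) :=
    contMDiff_proj_of_chartAt_eq hp hchart
  -- … holomorphic …
  have hψω : MDifferentiable 𝓘(ℂ, A.model) 𝓘(ℂ, A.model)
      (A.isAnalytification.isHomeomorph.homeomorph.symm ∘ D.levelProj N) :=
    (contMDiff_proj_of_chartAt_eq (I := 𝓘(ℂ, A.model)) (n := ω) hp hchart).mdifferentiable
      (by simp)
  -- … so that its real differential is `ℂ`-linear …
  have hψJ : ∀ (x : D.LevelCover N) (v : TangentSpace 𝓘(ℝ, A.model) x),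
      mfderiv 𝓘(ℝ, A.model) 𝓘(ℝ, A.model)
          (A.isAnalytification.isHomeomorph.homeomorph.symm ∘ D.levelProj N) x (tangentJ A.model x v) =
        tangentJ A.model ((A.isAnalytification.isHomeomorph.homeomorph.symm ∘ D.levelProj N) x)
          (mfderiv 𝓘(ℝ, A.model) 𝓘(ℝ, A.model)
            (A.isAnalytification.isHomeomorph.homeomorph.symm ∘ D.levelProj N) x v) :=
    fun x v ↦ mfderiv_tangentJ (hψω x) v
  -- … and injective (indeed bijective: `pL` is a local diffeomorphism)
  have hψi : ∀ x : D.LevelCover N, Function.Injective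
      (mfderiv 𝓘(ℝ, A.model) 𝓘(ℝ, A.model)
        (A.isAnalytification.isHomeomorph.homeomorph.symm ∘ D.levelProj N) x) := fun x ↦
    (bijective_mfderiv_proj_of_chartAt_eq (I := 𝓘(ℝ, A.model)) (n := ∞) hp hchart (by simp)
      x).injective
  -- pull the Kähler metric back
  obtain ⟨g, hg, -⟩ := exists_isKaehler_inner_eq_pullback G hG hψ hψJ hψi
  exact ⟨⟨g, hg⟩⟩

end Summit.HodgeConjecture.HodgeConjecture.Cruxes.OrthogonalEnveloped.PuritySortedHeckeEnvelope

end
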